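import Literature.MathematicalPhysics.QuantumFieldTheory.Balaban1983to89.B12B0Restriction267
import Literature.MathematicalPhysics.QuantumFieldTheory.Balaban1983to89.B12Average012AnalyticIter

/-!
# `Balaban1983to89.B12B0RestrictionAverage267` — [Balaban1987RG1] pp. 266–267: the rider «restrictions on B′(b₀(c)),
with the constant ε₁ replaced by O(ε₁)» for the GENUINE LINEARIZATION `LQ̃_V` OF [I]'S AVERAGE (0.12)/(0.11):
hypotheses (H) and (S) of `B12B0Restriction267.norm_apply_b0_le` DISCHARGED, (L) discharged qualitatively

HONEST FRAMING (cell `lit-balaban`, verbatim): statement-level skeleton of published theorems with citation tags;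
proofs where landed; nothing here is a claim about the Yang–Mills mass gap.

CITATION HEADER.  T. Bałaban, *Renormalization group approach to lattice gauge field theories. I*, Commun. Math. Phys.
**109** (1987) 249–301 [Balaban1987RG1] (cell paper B12; PDF held `paper:balaban1987-cmp109-rg-i-small-field`, journal
page = PDF page + 248), pp. 266–268 [PDF 18–20]; [Balaban1985Averaging] ([B7]) Prop. 4 p. 38 (locality of the averaging
function) only through the tree.  Unit `lit-balaban-r09` gen 11 (reader/typer of CMP 109; TAKING line HOME/STATUS.md
2026-08-21T20:37:30Z), SKELETON rows `B12.Eq2.9` (the rider after (2.9)), `B12.Def@267` (the operator `h`), `B12.Eq2.11`.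

WHAT IS PRINTED (verbatim).  p. 266–267: *«The above restrictions imply also restrictions on B′(b₀(c)), with the constant
ε₁ replaced by O(ε₁), because these variables can be expressed in terms of the remaining ones as in the first step.»*
p. 267: *«h(c) is a linear operator on the Lie algebra 𝐠, equal to an inverse of a coefficient at the variable B′(b₀(c))
in (Q̃B′)(c), multiplied by L⁻¹.»*; *«LQ̃B′ + C̃(B′)»* (the linear part `LQ̃` of (2.4)).

THE TYPING.  `B12B0Restriction267.norm_apply_b0_le` (r09 g10) proves the rider at the linear level from (L) a locality
BOUND `‖(LQ̃B)(c)‖ ≤ K·sup_{N(c)}‖B‖`, (H) `‖X‖ ≤ H·‖coeff_c X‖`, (S) separation; `B12B0RestrictionMainTerm` discharged all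
three for the MAIN TERM `Q₀`.  THIS MODULE treats the GENUINE linearization `LQ̃_V = B12AverageCorridor267.LQ L 𝐔 V` of
(2.4) for [I]'s average (0.12) over the averaged contour variables (0.11) (`𝒯 = B12ContourAverage253.Tavg`, the b12
lineage's `ℤᵈ` corner-cube carrier, DIVERGENCE D-b12g20.1) at a bondwise-unitary `ε₀`-regular background `V`:
* (H) DISCHARGED (§ 2): the corridor coefficient `bcoef_c` of `LQ̃_V` is `K(c) − S(c)` (`bcoef_LQ_eq_coef_sub`), and the
  lineage's Neumann inverse `h(c)` (`hGen`/`hAverage`, [I] p. 267's `h`) is a TWO-SIDED inverse: `h(c)(bcoef_c X) = X`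
  (`hGen_bcoef`, from `B12HOperatorNeumann267.perturbInv_perturb`), hence **`‖X‖ ≤ H·‖bcoef_c X‖`** with
  `H = (Lᵈ/L)/(1 − (Lᵈ/L)·24ε)` (`norm_le_mul_norm_bcoef`), for [I]'s average `ε = ω_A(ε₀) = 10(dL)²ε₀`
  (`norm_le_mul_norm_bcoef_average`);
* (S) is the tree's `B13CorridorSeparation.eq_of_b0Z_mem_qppBonds`;
* (L) DISCHARGED QUALITATIVELY (§ 3): for every `V` and `c` there IS a constant `K = K(V, c) ≥ 0` with
  `‖(LQ̃_V B)(c)‖ ≤ K·M` whenever `‖B(b)‖ ≤ M` on the bonds of `B(c₋) ∪ B(c₊)` — the operator norm of the Fréchet derivative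
  of `Q̃_V(·)(c)` on the finite field space (r09 g9 `B12Average012AnalyticIter.fderiv_Qtilde_fields_apply`) combined with
  the [B7] Prop. 4 locality `isQppLocal_LQ` (`exists_locality_const`).  The UNIFORM constant (print's absolute `O(1)`; a
  [B7] (126)-type operator bound for the linearization of the average (0.11)) is NOT in the tree and enters the
  quantitative statement as the hypothesis `hK` AT the coarse bond `c`;
* THE RIDER (§ 4): a pointwise-in-`c` form of r09 g10's abstract lemma for an ADDITIVE constraint map
  (`norm_apply_b0_le_at`; additivity of `LQ̃_V` is r09 g9's `B12Average012Analytic.LQ_add`), whence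
  **`norm_b0Z_le_of_LQ_eq_zero`**: `(LQ̃_V B)(c) = 0`, `‖B(b)‖ ≤ M` at the non-distinguished bonds ⇒
  `‖B(b₀(c))‖ ≤ H·K·M`, and the hypothesis-free existential form **`exists_const_norm_b0Z_le`** (`O(1) = O_{V,c}(1)`).
HONEST SCOPE.  Linear level only (as in `B12B0Restriction267`); `ℤᵈ` corner cubes; the constant of (L) is per `(V, c)`
unless supplied; nothing of the nonlinear elimination «as in the first step» is claimed.

WHAT IS PROVED: theorems only (no definition, no `Prop`-fact, no sorry; axioms standard).
-/

noncomputable section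

namespace Literature.MathematicalPhysics.QuantumFieldTheory.Balaban1983to89.B12B0RestrictionAverage267

open Literature.MathematicalPhysics.QuantumLattice (ZdEdge plaquetteHolonomyZd)
open B7Prop1Explicit (U1 mem_U1)
open B7BlockGeometry (qppBonds)
open B12HOperator267 (bcoef)
open B12HOperatorNeumann267 (KMain KMain_apply perturbInv_perturb)
open B12AverageCorridor267 (LQ Qtilde IsBlockLocal IsAxisStraightFamily loopW offAxis hGen bcoef_LQ_eq_coef_sub
  relPert_lt_one axisStraight_conj norm_Rconj_le norm_Rconj_inv_le Scorr isQppLocal_LQ h_paragraph_p267_genuine)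
open B12ContourAverage253 (Tavg hAverage omegaA omegaA_nonneg isBlockLocal_Tavg isAxisStraightFamily_Tavg
  norm_loopW_Tavg_sub_one_le)
open B12Average012Analytic (LQ_add)
open B12Average012AnalyticIter (fderiv_Qtilde_fields_apply)
open B13CorridorSeparation (b0Z eq_of_b0Z_mem_qppBonds b0Z_mem_qppBonds)
open B12B0Restriction267 (single_add_update)

/-! ## §1. The rider at ONE coarse bond, for an additive constraint map (pointwise form of `norm_apply_b0_le`) -/

section Abstract

variable {β C 𝔤 : Type*} [DecidableEq β] [NormedAddCommGroup 𝔤]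

/-- «these variables can be expressed in terms of the remaining ones» at one coarse bond: for an ADDITIVE map
`Λ_c : (fine bond fields) → 𝐠` (the `c`-component of `LQ̃`) and `Λ_c B = 0`,
`Λ_c(δ_{b}B(b)) = −Λ_c(B[b ↦ 0])`. [cite: Balaban1987RG1, p.267] -/
theorem apply_single_eq_neg_of_eq_zero {Λ : (β → 𝔤) → 𝔤} (hadd : ∀ B₁ B₂, Λ (B₁ + B₂) = Λ B₁ + Λ B₂) (b : β)
    {B : β → 𝔤} (hB : Λ B = 0) : Λ (Pi.single b (B b)) = -Λ (Function.update B b 0) := by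
  have h := congrArg Λ (single_add_update B b)
  rw [hadd, hB] at h
  exact eq_neg_of_add_eq_zero_left h

/-- **The rider at the linear level, AT ONE COARSE BOND `c`** (pointwise form of
`B12B0Restriction267.norm_apply_b0_le`, for an additive `Λ_c`): (L) `‖Λ_c B‖ ≤ K·M` whenever `‖B‖ ≤ M` on `N`,
(H) `‖X‖ ≤ H·‖Λ_c(δ_{b₀(c)}X)‖`, (S) no foreign `b₀(c′)` in `N`; then `Λ_c B = 0` and `‖B(b)‖ ≤ M` at the
non-distinguished bonds give `‖B(b₀(c))‖ ≤ H·K·M`. [cite: Balaban1987RG1, (2.9) p.266] -/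
theorem norm_apply_b0_le_at {b₀ : C → β} {N : Set β} {Λ : (β → 𝔤) → 𝔤} {K H M : ℝ} (c : C)
    (hadd : ∀ B₁ B₂, Λ (B₁ + B₂) = Λ B₁ + Λ B₂)
    (hK : ∀ (B : β → 𝔤) (M : ℝ), (∀ b ∈ N, ‖B b‖ ≤ M) → ‖Λ B‖ ≤ K * M)
    (hH : ∀ X : 𝔤, ‖X‖ ≤ H * ‖Λ (Pi.single (b₀ c) X)‖) (hH0 : 0 ≤ H)
    (hsep : ∀ c' : C, b₀ c' ∈ N → c' = c)
    {B : β → 𝔤} (hB : Λ B = 0) (hM0 : 0 ≤ M) (hM : ∀ b : β, (¬ ∃ c' : C, b₀ c' = b) → ‖B b‖ ≤ M) :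
    ‖B (b₀ c)‖ ≤ H * K * M := by
  have h1 := hH (B (b₀ c))
  rw [apply_single_eq_neg_of_eq_zero hadd (b₀ c) hB, norm_neg] at h1
  have h2 : ‖Λ (Function.update B (b₀ c) 0)‖ ≤ K * M := by
    refine hK _ M fun b hb => ?_
    by_cases hbb : b = b₀ c
    · subst hbb
      rw [Function.update_self, norm_zero]
      exact hM0
    · rw [Function.update_of_ne hbb]
      refine hM b ?_
      rintro ⟨c', rfl⟩
      exact hbb (congrArg b₀ (hsep c' hb))
  calc ‖B (b₀ c)‖ ≤ H * ‖Λ (Function.update B (b₀ c) 0)‖ := h1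
    _ ≤ H * (K * M) := mul_le_mul_of_nonneg_left h2 hH0
    _ = H * K * M := by ring

end Abstract

/-! ## §2. (H) for the genuine linearization: the Neumann inverse `h(c)` is two-sided, `‖X‖ ≤ H·‖bcoef_c X‖` -/

section Coefficient

variable {d : ℕ} {𝔸 : Type*} [NormedRing 𝔸] [NormedAlgebra ℂ 𝔸] [NormOneClass 𝔸] [CompleteSpace 𝔸]
variable {L : ℕ} {𝒯 : (ZdEdge d → 𝔸ˣ) → (Fin d → ℤ) → 𝔸ˣ}

/-- **`h(c)` IS A LEFT INVERSE OF THE CORRIDOR COEFFICIENT** of `LQ̃_V` (block-local, axis-straight transporter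
family; small field on the off-axis block loops; bondwise-unitary `V`; Neumann budget): `h(c)(bcoef_c X) = X` —
«an inverse of a coefficient at the variable B′(b₀(c))» in both directions (the tree's `h_paragraph_p267_genuine`
(i) is the right-inverse direction `LQ̃h = I`). [cite: Balaban1987RG1, p.267] -/
theorem hGen_bcoef (hL : 0 < L) (h𝒯 : IsBlockLocal L 𝒯) (h𝒯' : IsAxisStraightFamily L 𝒯) (V : ZdEdge d → 𝔸ˣ)
    {ε : ℝ} (hε0 : 0 ≤ ε) (hε : ε ≤ 1 / 8)
    (hW : ∀ c, ∀ x ∈ offAxis L c, ‖((loopW L 𝒯 V c x : 𝔸ˣ) : 𝔸) - 1‖ ≤ ε)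
    (hV : ∀ b, ‖((V b : 𝔸ˣ) : 𝔸)‖ ≤ 1) (hV' : ∀ b, ‖(((V b)⁻¹ : 𝔸ˣ) : 𝔸)‖ ≤ 1)
    (hbud : (L : ℝ) ^ d / L * (24 * ε) < 1) (c : ZdEdge d) (X : 𝔸) :
    hGen hL h𝒯' V hε0 hε hW hV hV' hbud c (bcoef L (LQ L 𝒯 V) c X) = X := by
  rw [bcoef_LQ_eq_coef_sub hL h𝒯 h𝒯' V c X fun x hx => (hW c x hx).trans_lt (by linarith)]
  have h := perturbInv_perturb (KMain (axisStraight_conj h𝒯' V) hL (norm_Rconj_le hV) (norm_Rconj_inv_le hV') c)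
    (Scorr L 𝒯 V c) (relPert_lt_one hL h𝒯' V hε0 hε hW hV hV' hbud c) X
  rw [sub_apply, ContinuousLinearEquiv.coe_coe, KMain_apply] at h
  exact h

/-- **(H) FOR THE GENUINE LINEARIZATION**: `‖X‖ ≤ H·‖bcoef_c X‖`, `H = (Lᵈ/L)/(1 − (Lᵈ/L)·24ε)` — the corridor
coefficient of `LQ̃_V` is bounded below (the cell's bound (iii) on `h(c)` applied to `bcoef_c X`, of which `X` is the
image). [cite: Balaban1987RG1, p.267] -/
theorem norm_le_mul_norm_bcoef (hL : 0 < L) (h𝒯 : IsBlockLocal L 𝒯) (h𝒯' : IsAxisStraightFamily L 𝒯)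
    (V : ZdEdge d → 𝔸ˣ) {ε : ℝ} (hε0 : 0 ≤ ε) (hε : ε ≤ 1 / 8)
    (hW : ∀ c, ∀ x ∈ offAxis L c, ‖((loopW L 𝒯 V c x : 𝔸ˣ) : 𝔸) - 1‖ ≤ ε)
    (hV : ∀ b, ‖((V b : 𝔸ˣ) : 𝔸)‖ ≤ 1) (hV' : ∀ b, ‖(((V b)⁻¹ : 𝔸ˣ) : 𝔸)‖ ≤ 1)
    (hbud : (L : ℝ) ^ d / L * (24 * ε) < 1) (c : ZdEdge d) (X : 𝔸) :
    ‖X‖ ≤ ((L : ℝ) ^ d / L) / (1 - (L : ℝ) ^ d / L * (24 * ε)) * ‖bcoef L (LQ L 𝒯 V) c X‖ := by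
  have h3 := (h_paragraph_p267_genuine hL h𝒯 h𝒯' V hε0 hε hW hV hV' hbud).2.2 c (bcoef L (LQ L 𝒯 V) c X)
  rwa [hGen_bcoef hL h𝒯 h𝒯' V hε0 hε hW hV hV' hbud c X] at h3

/-- The constant `H` is nonnegative (indeed `≥ Lᵈ/L`). [cite: Balaban1987RG1, p.267] -/
theorem H_nonneg (L d : ℕ) {ε : ℝ} (hbud : (L : ℝ) ^ d / L * (24 * ε) < 1) :
    0 ≤ ((L : ℝ) ^ d / L) / (1 - (L : ℝ) ^ d / L * (24 * ε)) :=
  div_nonneg (by positivity) (by linarith)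

/-- `h(c)` of [I]'s average (0.12)/(0.11) (`B12ContourAverage253.hAverage`) is a left inverse of the corridor
coefficient of `LQ̃_U`, on bondwise-unitary `ε₀`-regular configurations. [cite: Balaban1987RG1, p.267] -/
theorem hAverage_bcoef (hL : 0 < L) (hd : 1 ≤ d) (U : ZdEdge d → 𝔸ˣ) (hU : ∀ b, ‖((U b : 𝔸ˣ) : 𝔸)‖ ≤ 1)
    (hU' : ∀ b, ‖(((U b)⁻¹ : 𝔸ˣ) : 𝔸)‖ ≤ 1) {ε₀ : ℝ} (hε₀ : 0 ≤ ε₀)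
    (h44 : ∀ (p : Fin d → ℤ) (i j : Fin d), i ≠ j → ‖((plaquetteHolonomyZd U p i j : 𝔸ˣ) : 𝔸) - 1‖ ≤ ε₀)
    (hsm : ((d : ℝ) * L) ^ 2 * ε₀ ≤ 1 / 100) (hω : omegaA d L ε₀ ≤ 1 / 8)
    (hbud : (L : ℝ) ^ d / L * (24 * omegaA d L ε₀) < 1) (c : ZdEdge d) (X : 𝔸) :
    hAverage hL hd U hU hU' hε₀ h44 hsm hω hbud c (bcoef L (LQ L (fun U : ZdEdge d → 𝔸ˣ => Tavg L U) U) c X) = X :=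
  hGen_bcoef hL (isBlockLocal_Tavg hL) (isAxisStraightFamily_Tavg hL) U (omegaA_nonneg d L hε₀) hω
    (norm_loopW_Tavg_sub_one_le hL hd U hU hU' hε₀ hsm h44) hU hU' hbud c X

/-- **(H) FOR [I]'S AVERAGE (0.12) WITH THE AVERAGED CONTOUR VARIABLES (0.11)**: on bondwise-unitary `ε₀`-regular
configurations (`(dL)²ε₀ ≤ 1/100`, `ω_A(ε₀) = 10(dL)²ε₀ ≤ 1/8`, `(Lᵈ/L)·24ω_A < 1`) the corridor coefficient of
`LQ̃_U` is bounded below: `‖X‖ ≤ H(ε₀)·‖bcoef_c X‖`, `H(ε₀) = (Lᵈ/L)/(1 − (Lᵈ/L)·24ω_A(ε₀))`.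
[cite: Balaban1987RG1, p.267] -/
theorem norm_le_mul_norm_bcoef_average (hL : 0 < L) (hd : 1 ≤ d) (U : ZdEdge d → 𝔸ˣ)
    (hU : ∀ b, ‖((U b : 𝔸ˣ) : 𝔸)‖ ≤ 1) (hU' : ∀ b, ‖(((U b)⁻¹ : 𝔸ˣ) : 𝔸)‖ ≤ 1) {ε₀ : ℝ} (hε₀ : 0 ≤ ε₀)
    (h44 : ∀ (p : Fin d → ℤ) (i j : Fin d), i ≠ j → ‖((plaquetteHolonomyZd U p i j : 𝔸ˣ) : 𝔸) - 1‖ ≤ ε₀)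
    (hsm : ((d : ℝ) * L) ^ 2 * ε₀ ≤ 1 / 100) (hω : omegaA d L ε₀ ≤ 1 / 8)
    (hbud : (L : ℝ) ^ d / L * (24 * omegaA d L ε₀) < 1) (c : ZdEdge d) (X : 𝔸) :
    ‖X‖ ≤ ((L : ℝ) ^ d / L) / (1 - (L : ℝ) ^ d / L * (24 * omegaA d L ε₀)) *
      ‖bcoef L (LQ L (fun U : ZdEdge d → 𝔸ˣ => Tavg L U) U) c X‖ :=
  norm_le_mul_norm_bcoef hL (isBlockLocal_Tavg hL) (isAxisStraightFamily_Tavg hL) U (omegaA_nonneg d L hε₀) hω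
    (norm_loopW_Tavg_sub_one_le hL hd U hU hU' hε₀ hsm h44) hU hU' hbud c X

end Coefficient

/-! ## §3. (L), qualitatively: a locality constant `K(V, c)` for the genuine linearization of [I]'s average -/

section Locality

variable {d : ℕ} {𝔸 : Type*} [NormedRing 𝔸] [NormedAlgebra ℂ 𝔸] [NormOneClass 𝔸] [CompleteSpace 𝔸] {L : ℕ}

/-- **(L) FOR THE GENUINE LINEARIZATION OF [I]'S AVERAGE, QUALITATIVELY**: at every bondwise-unitary
`ε₀`-regular `V` (`(dL)²ε₀ < 1/100`, `d ≥ 1`) and every coarse bond `c` there is `K = K(V, c) ≥ 0` with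
`‖(LQ̃_V B)(c)‖ ≤ K·M` whenever `‖B(b)‖ ≤ M` on the bonds of `B(c₋) ∪ B(c₊)` — the operator norm of the Fréchet
derivative of `B ↦ Q̃_V(B)(c)` on the finite field space (r09 g9) together with the [B7] Prop. 4 locality of `LQ̃_V`;
the uniform constant (print's absolute `O(1)`) is not asserted. [cite: Balaban1987RG1, p.267] -/
theorem exists_locality_const (hL : 0 < L) (hd : 1 ≤ d) (V : ZdEdge d → 𝔸ˣ) (hV : ∀ b, V b ∈ U1 𝔸) {ε₀ : ℝ}
    (hε₀ : 0 ≤ ε₀) (hsm : ((d : ℝ) * L) ^ 2 * ε₀ < 1 / 100)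
    (h44 : ∀ (p : Fin d → ℤ) (i j : Fin d), i ≠ j → ‖((plaquetteHolonomyZd V p i j : 𝔸ˣ) : 𝔸) - 1‖ ≤ ε₀)
    (c : ZdEdge d) :
    ∃ K : ℝ, 0 ≤ K ∧ ∀ (B : ZdEdge d → 𝔸) (M : ℝ), (∀ b ∈ qppBonds L c, ‖B b‖ ≤ M) →
      ‖LQ L (fun U : ZdEdge d → 𝔸ˣ => Tavg L U) V B c‖ ≤ K * M := by
  classical
  refine ⟨‖fderiv ℂ (fun B : (↥(qppBonds L c) → 𝔸) =>
      Qtilde L (fun U : ZdEdge d → 𝔸ˣ => Tavg L U) V (fun b => if h : b ∈ qppBonds L c then B ⟨b, h⟩ else 0) c) 0‖,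
    ContinuousLinearMap.opNorm_nonneg _, fun B M hM => ?_⟩
  have hM0 : 0 ≤ M := (norm_nonneg _).trans (hM _ (b0Z_mem_qppBonds hL c))
  have hloc : LQ L (fun U : ZdEdge d → 𝔸ˣ => Tavg L U) V B c = LQ L (fun U : ZdEdge d → 𝔸ˣ => Tavg L U) V
      (fun b => if h : b ∈ qppBonds L c then (fun b' : ↥(qppBonds L c) => B b') ⟨b, h⟩ else 0) c :=
    isQppLocal_LQ hL (isBlockLocal_Tavg hL) V _ _ c fun b hb => by simp only [dif_pos hb]
  rw [hloc, ← fderiv_Qtilde_fields_apply hL hd V hV hε₀ hsm h44 (qppBonds L c) c (fun b' : ↥(qppBonds L c) => B b')]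
  refine (ContinuousLinearMap.le_opNorm _ _).trans (mul_le_mul_of_nonneg_left ?_ (norm_nonneg _))
  exact (pi_norm_le_iff_of_nonneg hM0).2 fun b => hM b b.2

end Locality

/-! ## §4. The rider for the genuine linearization of [I]'s average -/

section Rider

variable {d : ℕ} {𝔸 : Type*} [NormedRing 𝔸] [NormedAlgebra ℂ 𝔸] [NormOneClass 𝔸] [CompleteSpace 𝔸] {L : ℕ}

/-- **THE p. 266–267 RIDER FOR THE GENUINE LINEARIZATION `LQ̃_U` OF [I]'S AVERAGE**, at one coarse bond `c`, with the
locality constant `K` of (L) at `c` as the input (a [B7] (126)-type bound; `exists_locality_const` provides one for each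
`(U, c)`): on bondwise-unitary `ε₀`-regular `U`, if `(LQ̃_U B)(c) = 0` and `‖B(b)‖ ≤ M` at every non-distinguished bond,
then `‖B(b₀(c))‖ ≤ H(ε₀)·K·M` — «with the constant ε₁ replaced by O(ε₁)», `O(1) = H(ε₀)·K`; (H) by § 2, (S) by
`B13CorridorSeparation.eq_of_b0Z_mem_qppBonds`, additivity of `LQ̃_U` by `B12Average012Analytic.LQ_add`.
[cite: Balaban1987RG1, (2.9) p.266] -/
theorem norm_b0Z_le_of_LQ_eq_zero (hL : 0 < L) (hd : 1 ≤ d) (U : ZdEdge d → 𝔸ˣ) (hU1 : ∀ b, U b ∈ U1 𝔸)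
    {ε₀ : ℝ} (hε₀ : 0 ≤ ε₀)
    (h44 : ∀ (p : Fin d → ℤ) (i j : Fin d), i ≠ j → ‖((plaquetteHolonomyZd U p i j : 𝔸ˣ) : 𝔸) - 1‖ ≤ ε₀)
    (hsm : ((d : ℝ) * L) ^ 2 * ε₀ < 1 / 100) (hω : omegaA d L ε₀ ≤ 1 / 8)
    (hbud : (L : ℝ) ^ d / L * (24 * omegaA d L ε₀) < 1) (c : ZdEdge d) {K : ℝ}
    (hK : ∀ (B : ZdEdge d → 𝔸) (M : ℝ), (∀ b ∈ qppBonds L c, ‖B b‖ ≤ M) →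
      ‖LQ L (fun U : ZdEdge d → 𝔸ˣ => Tavg L U) U B c‖ ≤ K * M)
    {B : ZdEdge d → 𝔸} (hB : LQ L (fun U : ZdEdge d → 𝔸ˣ => Tavg L U) U B c = 0) {M : ℝ} (hM0 : 0 ≤ M)
    (hM : ∀ b : ZdEdge d, (¬ ∃ c' : ZdEdge d, b0Z L c' = b) → ‖B b‖ ≤ M) :
    ‖B (b0Z L c)‖ ≤ ((L : ℝ) ^ d / L) / (1 - (L : ℝ) ^ d / L * (24 * omegaA d L ε₀)) * K * M := by
  have hU : ∀ b, ‖((U b : 𝔸ˣ) : 𝔸)‖ ≤ 1 := fun b => (mem_U1.1 (hU1 b)).1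
  have hU' : ∀ b, ‖(((U b)⁻¹ : 𝔸ˣ) : 𝔸)‖ ≤ 1 := fun b => (mem_U1.1 (hU1 b)).2
  refine norm_apply_b0_le_at (b₀ := b0Z L) (N := (qppBonds L c : Set (ZdEdge d)))
    (Λ := fun B => LQ L (fun U : ZdEdge d → 𝔸ˣ => Tavg L U) U B c) c
    (fun B₁ B₂ => LQ_add hL hd U hU1 hε₀ hsm h44 B₁ B₂ c)
    (fun B M hBM => hK B M fun b hb => hBM b (Finset.mem_coe.2 hb))
    (fun X => norm_le_mul_norm_bcoef_average hL hd U hU hU' hε₀ h44 hsm.le hω hbud c X)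
    (H_nonneg L d hbud) (fun c' h => eq_of_b0Z_mem_qppBonds hL (Finset.mem_coe.1 h)) hB hM0 hM

/-- «with the constant ε₁ replaced by O(ε₁)»: strict version — the remaining variables `< ε₁` give
`‖B(b₀(c))‖ ≤ H(ε₀)·K·ε₁`. [cite: Balaban1987RG1, (2.9) p.266] -/
theorem norm_b0Z_le_of_LQ_eq_zero_lt (hL : 0 < L) (hd : 1 ≤ d) (U : ZdEdge d → 𝔸ˣ) (hU1 : ∀ b, U b ∈ U1 𝔸)
    {ε₀ : ℝ} (hε₀ : 0 ≤ ε₀)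
    (h44 : ∀ (p : Fin d → ℤ) (i j : Fin d), i ≠ j → ‖((plaquetteHolonomyZd U p i j : 𝔸ˣ) : 𝔸) - 1‖ ≤ ε₀)
    (hsm : ((d : ℝ) * L) ^ 2 * ε₀ < 1 / 100) (hω : omegaA d L ε₀ ≤ 1 / 8)
    (hbud : (L : ℝ) ^ d / L * (24 * omegaA d L ε₀) < 1) (c : ZdEdge d) {K : ℝ}
    (hK : ∀ (B : ZdEdge d → 𝔸) (M : ℝ), (∀ b ∈ qppBonds L c, ‖B b‖ ≤ M) →
      ‖LQ L (fun U : ZdEdge d → 𝔸ˣ => Tavg L U) U B c‖ ≤ K * M)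
    {B : ZdEdge d → 𝔸} (hB : LQ L (fun U : ZdEdge d → 𝔸ˣ => Tavg L U) U B c = 0) {ε₁ : ℝ} (hε₁ : 0 < ε₁)
    (hM : ∀ b : ZdEdge d, (¬ ∃ c' : ZdEdge d, b0Z L c' = b) → ‖B b‖ < ε₁) :
    ‖B (b0Z L c)‖ ≤ ((L : ℝ) ^ d / L) / (1 - (L : ℝ) ^ d / L * (24 * omegaA d L ε₀)) * K * ε₁ :=
  norm_b0Z_le_of_LQ_eq_zero hL hd U hU1 hε₀ h44 hsm hω hbud c hK hB hε₁.le fun b hb => (hM b hb).le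

/-- **THE RIDER, HYPOTHESIS-FREE IN EXISTENTIAL FORM** (`O(1) = O_{U,c}(1)`): for [I]'s average at a bondwise-unitary
`ε₀`-regular `U` and every coarse bond `c` there is `C ≥ 0` such that every `B` on the linearized constraint surface at
`c` with `‖B(b)‖ ≤ M` at the non-distinguished bonds has `‖B(b₀(c))‖ ≤ C·M`. [cite: Balaban1987RG1, (2.9) p.266] -/
theorem exists_const_norm_b0Z_le (hL : 0 < L) (hd : 1 ≤ d) (U : ZdEdge d → 𝔸ˣ) (hU1 : ∀ b, U b ∈ U1 𝔸)
    {ε₀ : ℝ} (hε₀ : 0 ≤ ε₀)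
    (h44 : ∀ (p : Fin d → ℤ) (i j : Fin d), i ≠ j → ‖((plaquetteHolonomyZd U p i j : 𝔸ˣ) : 𝔸) - 1‖ ≤ ε₀)
    (hsm : ((d : ℝ) * L) ^ 2 * ε₀ < 1 / 100) (hω : omegaA d L ε₀ ≤ 1 / 8)
    (hbud : (L : ℝ) ^ d / L * (24 * omegaA d L ε₀) < 1) (c : ZdEdge d) :
    ∃ C : ℝ, 0 ≤ C ∧ ∀ (B : ZdEdge d → 𝔸) (M : ℝ), LQ L (fun U : ZdEdge d → 𝔸ˣ => Tavg L U) U B c = 0 →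
      0 ≤ M → (∀ b : ZdEdge d, (¬ ∃ c' : ZdEdge d, b0Z L c' = b) → ‖B b‖ ≤ M) → ‖B (b0Z L c)‖ ≤ C * M := by
  obtain ⟨K, hK0, hK⟩ := exists_locality_const hL hd U hU1 hε₀ hsm h44 c
  refine ⟨((L : ℝ) ^ d / L) / (1 - (L : ℝ) ^ d / L * (24 * omegaA d L ε₀)) * K,
    mul_nonneg (H_nonneg L d hbud) hK0, fun B M hB hM0 hM => ?_⟩
  exact norm_b0Z_le_of_LQ_eq_zero hL hd U hU1 hε₀ h44 hsm hω hbud c hK hB hM0 hM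

end Rider

end Literature.MathematicalPhysics.QuantumFieldTheory.Balaban1983to89.B12B0RestrictionAverage267

end
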